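import Mathlib
import HarnessLib
import Literature.MathematicalPhysics.QuantumFieldTheory.GaussianQuadraticMGF
import Literature.NumberTheory.Sieve.BombieriAsymptoticSieveMertens
import Literature.Analysis.Complex.UnivalentNearbyPoints

/-!
# Comparison of two non-degenerate centred Gaussians with close covariances: the density ratio and
# `|E_{N(0,S₁)} H − E_{N(0,S₀)} H| ≤ C δ ‖H‖_{L^p(N(0,S₀))}` ([Buc16] Thm 4.5 / [ABKM19] Thm 6.2, crude core)

[Buc16] Theorem 4.5 (= [ABKM19] Theorem 6.2) bounds the derivative of a Gaussian expectation
`∫ F dμ_{𝒞_{A,k+1}}` in the coefficient matrix `A` by `C_p ‖F‖_{L^p}` — no derivative of `F` is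
used, only the density of the Gaussian and Hölder's inequality; the delicate part of the source is the
volume-independence of the constant.  This file proves the CRUDE finite-dimensional core, with a
dimension-dependent constant, which is what the Brouwer form of the fine tuning
(`RGFlow.exists_isTunedQ_initial_eq_of_finiteDimensional`) consumes: for positive definite `S₀, S₁`
with precisions `P_j = S_j⁻¹` satisfying `|yᵀ(P₀ − P₁)y| ≤ δ·yᵀP₀y`,

* `gaussRatio S₀ S₁` — the density `dN(0,S₁)/dN(0,S₀) = (Z₀/Z₁) e^{½ yᵀ(P₀−P₁)y}`,
  **`multivariateGaussian_eq_withDensity_gaussRatio`**, `integral_multivariateGaussian_eq_integral_gaussRatio_mul`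
  (`E_{S₁}[H] = E_{S₀}[r H]`), `integral_gaussRatio` (`E_{S₀}[r] = 1`);
* `integral_exp_half_smul_quadForm_precision` — `E_{N(0,S)}[e^{½ t yᵀS⁻¹y}] = (1 − t)^{−|ι|/2}`
  (`t < 1`), from the tree's `integral_exp_dotProduct_add_half_quadForm_multivariateGaussian`;
* the elementary inequality `le_mul_exp_div` (`x ≤ a e^{x/a}`); `|eˣ − 1| ≤ |x|e^{|x|}` and `−2δ ≤ log(1−δ)`
  are the tree's `BombieriSieve.abs_exp_sub_one_le` and `UnivalentNearbyPoints.log_one_sub_ge`.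

The comparison estimate itself (`abs_integral_multivariateGaussian_sub_le`) is in
`GaussianCovarianceComparisonEstimate.lean`.  Everything is proved; no named fact.

## References
* S. Buchholz, J. Funct. Anal. 275 (2018), Thm 4.5 and its proof (density derivative + Hölder)
  [Buchholz2016].
* S. Adams, S. Buchholz, R. Kotecký, S. Müller, arXiv:1910.13564, Theorem 6.2 [AdamsBuchholzKoteckyMuller2019].
-/

noncomputable section

namespace Literature.MathematicalPhysics.QuantumFieldTheory

open MeasureTheory ProbabilityTheory Matrix WithLp GaussianToolkit
open scoped ENNReal NNReal MatrixOrder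

variable {ι : Type*} [Fintype ι] [DecidableEq ι]

/-! ## The density ratio of two non-degenerate centred Gaussians -/

/-- The density `dN(0,S₁)/dN(0,S₀)(y) = (Z_{S₀⁻¹}/Z_{S₁⁻¹}) · exp(½ yᵀ(S₀⁻¹ − S₁⁻¹) y)` (as an
extended non-negative real). [cite: Buchholz2016, Thm 4.5 (proof)] -/
def gaussRatio (S₀ S₁ : Matrix ι ι ℝ) (y : EuclideanSpace ℝ ι) : ℝ≥0∞ :=
  gaussZ S₀⁻¹ * (gaussZ S₁⁻¹)⁻¹ *
    ENNReal.ofReal (Real.exp ((ofLp y ⬝ᵥ (S₀⁻¹ - S₁⁻¹) *ᵥ ofLp y) / 2))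

omit [DecidableEq ι] in
/-- The exponential factor of `gaussRatio` is continuous in `y`. [cite: Buchholz2016, Thm 4.5 (proof)] -/
theorem continuous_exp_half_quadForm (B : Matrix ι ι ℝ) :
    Continuous fun y : EuclideanSpace ℝ ι => Real.exp ((ofLp y ⬝ᵥ B *ᵥ ofLp y) / 2) := by
  have hc : Continuous fun x : EuclideanSpace ℝ ι => (ofLp x : ι → ℝ) := PiLp.continuous_ofLp 2 _
  exact Real.continuous_exp.comp ((hc.dotProduct (continuous_const.matrix_mulVec hc)).div_const _)

/-- `gaussRatio` is measurable. [cite: Buchholz2016, Thm 4.5 (proof)] -/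
theorem measurable_gaussRatio (S₀ S₁ : Matrix ι ι ℝ) : Measurable (gaussRatio S₀ S₁) := by
  unfold gaussRatio
  exact measurable_const.mul (ENNReal.measurable_ofReal.comp (continuous_exp_half_quadForm _).measurable)

/-- **`N(0,S₁) = gaussRatio S₀ S₁ · N(0,S₀)`** for positive definite `S₀, S₁`.
[cite: Buchholz2016, Thm 4.5 (proof)] -/
theorem multivariateGaussian_eq_withDensity_gaussRatio {S₀ S₁ : Matrix ι ι ℝ} (hS₀ : S₀.PosDef)
    (hS₁ : S₁.PosDef) :
    multivariateGaussian 0 S₁ = (multivariateGaussian 0 S₀).withDensity (gaussRatio S₀ S₁) := by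
  obtain ⟨h0, hZ0, hZ0t⟩ := multivariateGaussian_eq_withDensity hS₀
  obtain ⟨h1, -, -⟩ := multivariateGaussian_eq_withDensity hS₁
  have hmeas : Measurable (gaussRatio S₀ S₁) := measurable_gaussRatio S₀ S₁
  rw [h0, withDensity_smul_measure, ← withDensity_mul _ (measurable_gaussWeight _) hmeas]
  have hprod : gaussWeight S₀⁻¹ * gaussRatio S₀ S₁ =
      (gaussZ S₀⁻¹ * (gaussZ S₁⁻¹)⁻¹) • gaussWeight S₁⁻¹ := by
    funext y
    simp only [Pi.mul_apply, Pi.smul_apply, smul_eq_mul, gaussWeight, gaussRatio]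
    rw [mul_comm (ENNReal.ofReal _) (_ * _), mul_assoc, ← ENNReal.ofReal_mul (Real.exp_pos _).le,
      ← Real.exp_add]
    congr 2
    rw [Matrix.sub_mulVec, dotProduct_sub]
    ring
  rw [hprod, withDensity_smul _ (measurable_gaussWeight _), smul_smul, ← mul_assoc,
    ENNReal.inv_mul_cancel hZ0 hZ0t, one_mul, h1]

/-- **Change of measure**: `∫ H dN(0,S₁) = ∫ (gaussRatio y) · H(y) dN(0,S₀)` for every `H`.
[cite: Buchholz2016, Thm 4.5 (proof)] -/
theorem integral_multivariateGaussian_eq_integral_gaussRatio_mul {S₀ S₁ : Matrix ι ι ℝ}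
    (hS₀ : S₀.PosDef) (hS₁ : S₁.PosDef) (H : EuclideanSpace ℝ ι → ℝ) :
    ∫ y, H y ∂(multivariateGaussian 0 S₁) =
      ∫ y, (gaussRatio S₀ S₁ y).toReal * H y ∂(multivariateGaussian 0 S₀) := by
  obtain ⟨-, hZ1, hZ1t⟩ := multivariateGaussian_eq_withDensity hS₁
  obtain ⟨-, hZ0, hZ0t⟩ := multivariateGaussian_eq_withDensity hS₀
  rw [multivariateGaussian_eq_withDensity_gaussRatio hS₀ hS₁,
    integral_withDensity_eq_integral_toReal_smul (measurable_gaussRatio S₀ S₁)]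
  · simp only [smul_eq_mul]
  · refine Filter.Eventually.of_forall fun y => ?_
    unfold gaussRatio
    exact ENNReal.mul_lt_top (ENNReal.mul_lt_top hZ0t.lt_top (ENNReal.inv_lt_top.2 hZ1.bot_lt))
      ENNReal.ofReal_lt_top

/-- The ratio has total mass one: `∫ gaussRatio dN(0,S₀) = 1`. [cite: Buchholz2016, Thm 4.5 (proof)] -/
theorem integral_gaussRatio {S₀ S₁ : Matrix ι ι ℝ} (hS₀ : S₀.PosDef) (hS₁ : S₁.PosDef) :
    ∫ y, (gaussRatio S₀ S₁ y).toReal ∂(multivariateGaussian 0 S₀) = 1 := by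
  have h := integral_multivariateGaussian_eq_integral_gaussRatio_mul hS₀ hS₁ (fun _ => (1 : ℝ))
  simp only [mul_one, integral_const, smul_eq_mul, probReal_univ] at h
  exact h.symm

/-- The real density ratio as `κ · e^{½ yᵀ(P₀−P₁)y}` with `κ = (Z₀ Z₁⁻¹).toReal > 0`.
[cite: Buchholz2016, Thm 4.5 (proof)] -/
theorem toReal_gaussRatio {S₀ S₁ : Matrix ι ι ℝ} (y : EuclideanSpace ℝ ι) :
    (gaussRatio S₀ S₁ y).toReal = (gaussZ S₀⁻¹ * (gaussZ S₁⁻¹)⁻¹).toReal *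
      Real.exp ((ofLp y ⬝ᵥ (S₀⁻¹ - S₁⁻¹) *ᵥ ofLp y) / 2) := by
  unfold gaussRatio
  rw [ENNReal.toReal_mul, ENNReal.toReal_ofReal (Real.exp_pos _).le]

/-! ## Exponential moments of the precision form -/

/-- **`E_{N(0,S)}[e^{½ t · yᵀS⁻¹y}] = (√((1−t)^{|ι|}))⁻¹`** for positive definite `S` and `t < 1`
(`yᵀS⁻¹y = |S^{-1/2}y|²` is a `χ²_{|ι|}` variable). [cite: Buchholz2016, Thm 4.5 (proof)] -/
theorem integral_exp_half_smul_quadForm_precision {S : Matrix ι ι ℝ} (hS : S.PosDef) {t : ℝ}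
    (ht : t < 1) :
    ∫ y, Real.exp ((1/2 : ℝ) * (ofLp y ⬝ᵥ (t • S⁻¹) *ᵥ ofLp y)) ∂(multivariateGaussian 0 S) =
      (Real.sqrt ((1 - t) ^ Fintype.card ι))⁻¹ := by
  have hkey : (1 : Matrix ι ι ℝ) - CFC.sqrt S * (t • S⁻¹) * CFC.sqrt S = (1 - t) • (1 : Matrix ι ι ℝ) := by
    rw [Matrix.mul_smul, Matrix.smul_mul, ← sqrt_inv_mul_sqrt_inv hS]
    have hu : IsUnit (CFC.sqrt S) := isUnit_sqrt hS
    rw [← Matrix.mul_assoc, Matrix.mul_nonsing_inv _ ((Matrix.isUnit_iff_isUnit_det _).1 hu),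
      Matrix.one_mul, Matrix.nonsing_inv_mul _ ((Matrix.isUnit_iff_isUnit_det _).1 hu), sub_smul,
      one_smul]
  have hpd : ((1 : Matrix ι ι ℝ) - CFC.sqrt S * (t • S⁻¹) * CFC.sqrt S).PosDef := by
    rw [hkey]
    exact Matrix.PosDef.one.smul (by linarith)
  have h := integral_exp_dotProduct_add_half_quadForm_multivariateGaussian S hpd 0
  simp only [zero_dotProduct, zero_add, Matrix.mulVec_zero, dotProduct_zero, mul_zero,
    Real.exp_zero, mul_one] at h
  rw [h, hkey, Matrix.det_smul, Matrix.det_one, mul_one]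

/-- The exponential moment is attained by an integrable function (positivity of the closed form).
[cite: Buchholz2016, Thm 4.5 (proof)] -/
theorem integrable_exp_half_smul_quadForm_precision {S : Matrix ι ι ℝ} (hS : S.PosDef) {t : ℝ}
    (ht : t < 1) :
    Integrable (fun y : EuclideanSpace ℝ ι => Real.exp ((1/2 : ℝ) * (ofLp y ⬝ᵥ (t • S⁻¹) *ᵥ ofLp y)))
      (multivariateGaussian 0 S) := by
  by_contra hni
  have h := integral_exp_half_smul_quadForm_precision hS ht
  rw [integral_undef hni] at h
  have hpos : 0 < (Real.sqrt ((1 - t) ^ Fintype.card ι))⁻¹ :=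
    inv_pos.2 (Real.sqrt_pos.2 (pow_pos (by linarith) _))
  exact hpos.ne h

/-! ## Elementary inequalities -/

omit [Fintype ι] [DecidableEq ι] in
/-- `x ≤ a e^{x/a}` for `a > 0`. [cite: Buchholz2016, Thm 4.5 (proof)] -/
theorem le_mul_exp_div {a : ℝ} (ha : 0 < a) (x : ℝ) : x ≤ a * Real.exp (x / a) := by
  have h := Real.add_one_le_exp (x / a)
  have : x = a * (x / a) := by field_simp
  nlinarith [h, Real.exp_pos (x / a)]

end Literature.MathematicalPhysics.QuantumFieldTheory

end
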